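import Literature.AlgebraicGeometry.Motives.HodgeThetaSubalgebraUnitaryTwoOddCore
import Literature.AlgebraicGeometry.Motives.HodgeThetaSubalgebraUnitaryIdempotentCuts
import Mathlib.LinearAlgebra.Dual.Lemmas
import Mathlib.LinearAlgebra.Eigenspace.Triangularizable
import Mathlib.LinearAlgebra.Projection
import HarnessLib

/-!
# The `Θ`-subalgebra theorem beyond coprime multiplicities, I: an irreducible `𝔊 ∋ 1, Θ` with `dim P = 2` whose
# `P`-ANNIHILATOR IDEAL `𝔑 = {X ∈ 𝔊 : XΘ = ΘX, X|_P = 0}` acts irreducibly on `Q` is `End(W)`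
# (Ribet 1983 Thm. 3, Lie step; the first half of the `(2,4)` dichotomy — classification-free)

Family `hodge`, layer `Literature/AlgebraicGeometry/Motives` (pure complex linear algebra; no geometry). Written for the cell
`pub-hodgeav-hg6` (req-37 (A) row 2 «base of HC ladder», TABLE X row 8-`(4,2)`, the `(2,4)` complex core U2 =
`UnitaryThetaCore.top_or_radical_two_four`; eng-5 lineage g5, brick V1; honest framing of that cell: HC / HC_AV / HC_CM / H2
NOT proved — THIS file is unconditional linear algebra and discharges no hypothesis of the cell's cover). UNCONDITIONAL;
theorems only — no definition, no named fact (D-0026), no `sorry`. DERIVE-FROM-R61 rule: the rank-one toolkit and the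
rank-one criterion `UnitaryTwoOdd.eq_top_of_rankOne` of the tree's `(2, b odd)` core (`HodgeThetaSubalgebraUnitaryTwoOddCore`,
cell `pub-hodge-ring2`, lit g83) and the cut lemma `UnitaryThetaCore.raise_mul_mem` (`…UnitaryIdempotentCuts`) are IMPORTED,
never re-proved.

THE PRINT. K. A. Ribet, Amer. J. Math. 105 (1983), Thm. 3 (Gordon's survey Thm. 6.3 (3), pp. 18–19): for `End⁰(A) = k`
imaginary quadratic acting with COPRIME multiplicities `(n′, n″)`, `Hg(A) = U_k(V,ψ)`; for non-coprime multiplicities the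
Lie step may fail over `ℂ` (Moonen–Zarhin 1999 §2 (2.5): `(2,2)` in dimension 4), and at `(4,2)` (dimension 6, Tankeev 1996)
the only proper irreducible configuration is the tensor skeleton `𝔤𝔩₂ ⊗ 1 + 1 ⊗ 𝔤𝔩₃` on `ℂ² ⊗ ℂ³`. The present file isolates
the half of that dichotomy which does NOT depend on `dim Q`: the `P`-annihilator ideal decides.

SETTING (conventions of `UnitaryThetaCore`). `W` finite-dimensional over `ℂ`; `𝔊 ⊆ End(W)` a subspace closed under the
commutator, acting irreducibly, containing `1` and an involution `Θ` with eigenspaces `P = {Θ = 1}` (`dim P = 2`) and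
`Q = {Θ = −1}` (`dim Q ≥ 2`); raising operators `B` (`ΘB = B = −BΘ`: kill `P`, values in `P`), lowering `C`
(`ΘC = −C = −CΘ`). The `P`-ANNIHILATOR IDEAL is `𝔑 = {X ∈ 𝔊 : XΘ = ΘX, X(P) = 0}` (an ideal of the Levi part `𝔊₀`; it is
quantified inline, no definition): the hypothesis `hNirr` says that `Q` has no `𝔑`-stable subspace other than `0` and `Q`.

THE MECHANISM (new; Goodman–Wallach §4.1.1 gradings, Humphreys §19.1 rank-one operators, Hoffman–Kunze §3.7 annihilators).
For `X ∈ 𝔑` and `B` raising, `XB = 0`, so `B·X = [B, X] ∈ 𝔊` is again raising (`UnitaryThetaCore.raise_mul_mem`): the space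
`𝔊₊` of raising operators of `𝔊` is a RIGHT `𝔑`-MODULE inside `Hom(Q, P) = P ⊗ Q^*`. Hence, for `p₀ ∈ P`, the functionals
`β` killing `P` with `β ⊗ p₀ ∈ 𝔊` form a subspace `J` of `P° = Q^*` stable under `β ↦ β ∘ X`, whose joint kernel in `Q` is
`𝔑`-stable: it is `0` as soon as `J ≠ 0`, and then `J = P°` by a dimension count (§2). A rank-one raising operator exists
(§3): otherwise `B ↦ π₁ ∘ B` and `B ↦ π₂ ∘ B` (coordinates on `P`) are isomorphisms `𝔊₊ ≅ P°` and an eigenvector of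
`Φ₂Φ₁⁻¹` is a rank-one `β ⊗ (p₁ + c p₂)`. The covering fact (raising values span `P`,
`UnitaryThetaCore.mem_span_raise_apply`) moves the vector, so `𝔊₊ = Hom(Q, P)` (§4). Finally (§5), for the injective
lowering `C` of `UnitaryThetaCore.exists_lower_injOn`: `[[β ⊗ p, C], C] = −2 (βC) ⊗ (Cp) ∈ 𝔊`,
`[β ⊗ p′, (βC) ⊗ Cp] = (βC) ⊗ p′` gives the nilpotent rank-one operators of `𝔤𝔩(P) ⊕ 0`, and with `π_P = ½(1 + Θ) ∈ 𝔊` a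
rank-one IDEMPOTENT — so `𝔊 = End(W)` by `UnitaryTwoOdd.eq_top_of_rankOne`.

WHAT IS PROVED.
* §1 `β ⊗ p` algebra, `P ⊕ Q = W` (`UnitaryFourTwo.isCompl_of_invol`, `…finrank_add_finrank`, `…dual_ext`, `…end_ext`),
  coordinates on `P` (`UnitaryFourTwo.exists_coords`), `UnitaryFourTwo.finrank_le_of_inf_dualCoannihilator_eq_bot`.
* §2 **`UnitaryFourTwo.smulRight_mem_of_smulRight_mem`** — one rank-one raising `β₀ ⊗ p₀ ∈ 𝔊` gives all `β ⊗ p₀ ∈ 𝔊`.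
* §3 **`UnitaryFourTwo.exists_smulRight_mem`** — a rank-one raising operator exists in `𝔊` (`dim P = 2`).
* §4 **`UnitaryFourTwo.raise_mem_of_annP_irreducible`** — every raising operator lies in `𝔊`.
* §5 **`UnitaryFourTwo.eq_top_of_annP_irreducible`** — THE THEOREM: `𝔊 = End(W)`.
SEQUEL (not here; the cell's bricks V2–V5): when `Q` IS `𝔑`-reducible and `dim Q = 4`, the Levi algebra on `Q` has raising and
lowering LINES, `SymplecticThetaSix.skeleton_levi` applies, `𝔊` is the tensor skeleton, and the radical of `tr_W − ¾κ` on
`[𝔊, 𝔊]` is `𝔰𝔩₂ ⊗ 1` — the second disjunct of `UnitaryThetaCore.top_or_radical_two_four`.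

## References
* [Ribet1983] K. A. Ribet, *Hodge classes on certain types of abelian varieties*, Amer. J. Math. 105 (1983), Thm. 3.
* [Gordon1997] B. B. Gordon, *A survey of the Hodge conjecture for abelian varieties*, Thm. 6.3 (3) and pp. 18–19.
* [MoonenZarhin1999LowDim] B. Moonen, Yu. Zarhin, Math. Ann. 315 (1999), §2 (2.4)–(2.5), Thm. (2.7).
* [Tankeev1996] S. G. Tankeev, *Cycles on abelian varieties and exceptional numbers*, Izv. Math. 60 (1996) 391–424.
* [GoodmanWallachGTM255] R. Goodman, N. Wallach, *Symmetry, Representations, and Invariants*, §4.1.1 (gradings).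
* [Humphreys1972] J. E. Humphreys, *Introduction to Lie Algebras and Representation Theory*, §19.1 (`𝔤𝔩(V)`, rank one).
* [HoffmanKunze1971LinearAlgebra] K. Hoffman, R. Kunze, *Linear Algebra*, §3.5–§3.7 (functionals, annihilators, double dual),
  §6.7 (projections of a direct-sum decomposition).
-/

noncomputable section

open Module

namespace Literature.AlgebraicGeometry.Motives

namespace HodgeStructure

variable {W : Type*} [AddCommGroup W] [Module ℂ W]

/-! ### §1 Rank-one operators `β ⊗ p`, the decomposition `W = P ⊕ Q`, coordinates on `P` -/

section Prelim

/-- `(α + β) ⊗ u = α ⊗ u + β ⊗ u` for the rank-one operators `α.smulRight u : w ↦ α(w)u`. [cite: Humphreys1972, §19.1] -/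
theorem UnitaryFourTwo.add_smulRight (α β : Module.Dual ℂ W) (u : W) :
    (α + β).smulRight u = α.smulRight u + β.smulRight u :=
  LinearMap.ext fun w => by
    simp only [LinearMap.smulRight_apply, LinearMap.add_apply, add_smul]

/-- `(c·α) ⊗ u = c·(α ⊗ u)`. [cite: Humphreys1972, §19.1] -/
theorem UnitaryFourTwo.smul_smulRight (c : ℂ) (α : Module.Dual ℂ W) (u : W) :
    (c • α).smulRight u = c • α.smulRight u :=
  LinearMap.ext fun w => by
    simp only [LinearMap.smulRight_apply, LinearMap.smul_apply, smul_eq_mul, smul_smul]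

/-- `0 ⊗ u = 0`. [cite: Humphreys1972, §19.1] -/
theorem UnitaryFourTwo.zero_smulRight (u : W) : (0 : Module.Dual ℂ W).smulRight u = 0 :=
  LinearMap.ext fun w => by
    rw [LinearMap.smulRight_apply, LinearMap.zero_apply, zero_smul, LinearMap.zero_apply]

/-- `α ⊗ (u + v) = α ⊗ u + α ⊗ v`. [cite: Humphreys1972, §19.1] -/
theorem UnitaryFourTwo.smulRight_add (α : Module.Dual ℂ W) (u v : W) :
    α.smulRight (u + v) = α.smulRight u + α.smulRight v :=
  LinearMap.ext fun w => by
    simp only [LinearMap.smulRight_apply, LinearMap.add_apply, smul_add]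

/-- `α ⊗ (c·u) = c·(α ⊗ u)`. [cite: Humphreys1972, §19.1] -/
theorem UnitaryFourTwo.smulRight_smul (α : Module.Dual ℂ W) (c : ℂ) (u : W) :
    α.smulRight (c • u) = c • α.smulRight u :=
  LinearMap.ext fun w => by
    simp only [LinearMap.smulRight_apply, LinearMap.smul_apply, smul_smul, mul_comm (α w) c]

/-- An operator `B` with `BΘ = −B` kills `P = {Θ = 1}`. [cite: GoodmanWallachGTM255, §4.1.1] -/
theorem UnitaryFourTwo.apply_eq_zero_of_mul_theta {Θ B : Module.End ℂ W} (hBΘ : B * Θ = -B) {P : Submodule ℂ W}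
    (hP : ∀ x, x ∈ P ↔ Θ x = x) : ∀ p ∈ P, B p = 0 := fun p hp => by
  have h : B p = -(B p) := by
    conv_lhs => rw [← (hP p).1 hp]
    rw [← Module.End.mul_apply, hBΘ, LinearMap.neg_apply]
  have h2 : (2 : ℂ) • B p = 0 := by rw [two_smul]; nth_rewrite 2 [h]; rw [add_neg_cancel]
  exact (smul_eq_zero.1 h2).resolve_left two_ne_zero

/-- For `B` killing `P`, every `π ∘ B` lies in the annihilator `P°`. [cite: HoffmanKunze1971LinearAlgebra, §3.5] -/
theorem UnitaryFourTwo.comp_mem_dualAnnihilator {Θ B : Module.End ℂ W} (hBΘ : B * Θ = -B) {P : Submodule ℂ W}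
    (hP : ∀ x, x ∈ P ↔ Θ x = x) (π : Module.Dual ℂ W) : π ∘ₗ B ∈ P.dualAnnihilator := by
  rw [Submodule.mem_dualAnnihilator]
  intro p hp
  rw [LinearMap.comp_apply, UnitaryFourTwo.apply_eq_zero_of_mul_theta hBΘ hP p hp, map_zero]

/-- **A rank-one raising operator**: for `p ∈ P` and `β` killing `P` (`Θ² = 1`), `Θ (β ⊗ p) = β ⊗ p` and
`(β ⊗ p) Θ = −(β ⊗ p)`. [cite: GoodmanWallachGTM255, §4.1.1] [cite: Humphreys1972, §19.1] -/
theorem UnitaryFourTwo.raise_smulRight {Θ : Module.End ℂ W} (hΘΘ : Θ * Θ = 1) {P : Submodule ℂ W}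
    (hP : ∀ x, x ∈ P ↔ Θ x = x) {p : W} (hp : p ∈ P) {β : Module.Dual ℂ W} (hβ : ∀ x ∈ P, β x = 0) :
    Θ * β.smulRight p = β.smulRight p ∧ β.smulRight p * Θ = -β.smulRight p := by
  have hΘΘv : ∀ v, Θ (Θ v) = v := fun v => by rw [← Module.End.mul_apply, hΘΘ, Module.End.one_apply]
  refine ⟨by rw [UnitaryTwoOdd.mul_smulRight, (hP p).1 hp], ?_⟩
  rw [UnitaryTwoOdd.smulRight_mul]
  refine LinearMap.ext fun w => ?_
  have hw : w + Θ w ∈ P := (hP _).2 (by rw [map_add, hΘΘv, add_comm])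
  have h0 : β w + β (Θ w) = 0 := by rw [← map_add]; exact hβ _ hw
  rw [LinearMap.smulRight_apply, LinearMap.comp_apply, LinearMap.neg_apply, LinearMap.smulRight_apply,
    eq_neg_of_add_eq_zero_right h0, neg_smul]

/-- The eigenspaces `P = {Θ = 1}`, `Q = {Θ = −1}` of an involution are complementary: `w = ½(w + Θw) + ½(w − Θw)`.
[cite: GoodmanWallachGTM255, §4.1.1] -/
theorem UnitaryFourTwo.isCompl_of_invol {Θ : Module.End ℂ W} (hΘΘ : Θ * Θ = 1) {P Q : Submodule ℂ W}
    (hP : ∀ x, x ∈ P ↔ Θ x = x) (hQ : ∀ x, x ∈ Q ↔ Θ x = -x) : IsCompl P Q := by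
  have hΘΘv : ∀ v, Θ (Θ v) = v := fun v => by rw [← Module.End.mul_apply, hΘΘ, Module.End.one_apply]
  refine IsCompl.of_eq ?_ ?_
  · rw [eq_bot_iff]
    intro x hx
    obtain ⟨hxP, hxQ⟩ := Submodule.mem_inf.1 hx
    have h1 := (hP x).1 hxP
    have h2 := (hQ x).1 hxQ
    rw [h1] at h2
    have h3 : (2 : ℂ) • x = 0 := by rw [two_smul]; nth_rewrite 2 [h2]; rw [add_neg_cancel]
    rw [Submodule.mem_bot]
    exact (smul_eq_zero.1 h3).resolve_left two_ne_zero
  · rw [eq_top_iff]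
    intro w _
    have hsplit : (2 : ℂ)⁻¹ • (w + Θ w) + (2 : ℂ)⁻¹ • (w - Θ w) = w := by module
    rw [← hsplit]
    exact Submodule.add_mem_sup ((hP _).2 (by rw [map_smul, map_add, hΘΘv, add_comm]))
      ((hQ _).2 (by rw [map_smul, map_sub, hΘΘv, ← smul_neg, neg_sub]))

/-- `dim P + dim Q = dim W` for the two eigenspaces of an involution. [cite: HoffmanKunze1971LinearAlgebra, §6.7] -/
theorem UnitaryFourTwo.finrank_add_finrank [FiniteDimensional ℂ W] {Θ : Module.End ℂ W} (hΘΘ : Θ * Θ = 1)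
    {P Q : Submodule ℂ W} (hP : ∀ x, x ∈ P ↔ Θ x = x) (hQ : ∀ x, x ∈ Q ↔ Θ x = -x) :
    finrank ℂ P + finrank ℂ Q = finrank ℂ W := by
  have hc := UnitaryFourTwo.isCompl_of_invol hΘΘ hP hQ
  have h := Submodule.finrank_sup_add_finrank_inf_eq P Q
  rw [hc.sup_eq_top, hc.inf_eq_bot, finrank_top, finrank_bot, add_zero] at h
  exact h.symm

/-- Two functionals agreeing on `P` and on `Q` agree. [cite: HoffmanKunze1971LinearAlgebra, §6.7] -/
theorem UnitaryFourTwo.dual_ext {Θ : Module.End ℂ W} (hΘΘ : Θ * Θ = 1) {P Q : Submodule ℂ W}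
    (hP : ∀ x, x ∈ P ↔ Θ x = x) (hQ : ∀ x, x ∈ Q ↔ Θ x = -x) {φ ψ : Module.Dual ℂ W}
    (h1 : ∀ x ∈ P, φ x = ψ x) (h2 : ∀ x ∈ Q, φ x = ψ x) : φ = ψ := by
  have hΘΘv : ∀ v, Θ (Θ v) = v := fun v => by rw [← Module.End.mul_apply, hΘΘ, Module.End.one_apply]
  refine LinearMap.ext fun w => ?_
  have hsplit : (2 : ℂ)⁻¹ • (w + Θ w) + (2 : ℂ)⁻¹ • (w - Θ w) = w := by module
  have hPw : (2 : ℂ)⁻¹ • (w + Θ w) ∈ P := (hP _).2 (by rw [map_smul, map_add, hΘΘv, add_comm])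
  have hQw : (2 : ℂ)⁻¹ • (w - Θ w) ∈ Q := (hQ _).2 (by rw [map_smul, map_sub, hΘΘv, ← smul_neg, neg_sub])
  rw [← hsplit, map_add, map_add, h1 _ hPw, h2 _ hQw]

/-- Two endomorphisms agreeing on `P` and on `Q` agree. [cite: HoffmanKunze1971LinearAlgebra, §6.7] -/
theorem UnitaryFourTwo.end_ext {Θ : Module.End ℂ W} (hΘΘ : Θ * Θ = 1) {P Q : Submodule ℂ W}
    (hP : ∀ x, x ∈ P ↔ Θ x = x) (hQ : ∀ x, x ∈ Q ↔ Θ x = -x) {F G : Module.End ℂ W}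
    (h1 : ∀ x ∈ P, F x = G x) (h2 : ∀ x ∈ Q, F x = G x) : F = G := by
  have hΘΘv : ∀ v, Θ (Θ v) = v := fun v => by rw [← Module.End.mul_apply, hΘΘ, Module.End.one_apply]
  refine LinearMap.ext fun w => ?_
  have hsplit : (2 : ℂ)⁻¹ • (w + Θ w) + (2 : ℂ)⁻¹ • (w - Θ w) = w := by module
  have hPw : (2 : ℂ)⁻¹ • (w + Θ w) ∈ P := (hP _).2 (by rw [map_smul, map_add, hΘΘv, add_comm])
  have hQw : (2 : ℂ)⁻¹ • (w - Θ w) ∈ Q := (hQ _).2 (by rw [map_smul, map_sub, hΘΘv, ← smul_neg, neg_sub])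
  rw [← hsplit, map_add, map_add, h1 _ hPw, h2 _ hQw]

/-- **Coordinates on `P`.** For a basis `b` of `P` (indexed by `Fin 2`) there are functionals `π₀, π₁` on `W` killing `Q`
and dual to `b 0, b 1`; every `x ∈ P` is `π₀(x)·b 0 + π₁(x)·b 1`, and every operator `R` with values in `P` (`ΘR = R`) is
`R = (π₀ ∘ R) ⊗ b 0 + (π₁ ∘ R) ⊗ b 1`. (The `π_i` are the coordinate functionals composed with the projection of
`W = P ⊕ Q` onto `P`.) [cite: HoffmanKunze1971LinearAlgebra, §3.5 and §6.7] -/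
theorem UnitaryFourTwo.exists_coords {Θ : Module.End ℂ W} (hΘΘ : Θ * Θ = 1) {P Q : Submodule ℂ W}
    (hP : ∀ x, x ∈ P ↔ Θ x = x) (hQ : ∀ x, x ∈ Q ↔ Θ x = -x) (b : Module.Basis (Fin 2) ℂ P) :
    ∃ π₀ π₁ : Module.Dual ℂ W, (∀ q ∈ Q, π₀ q = 0) ∧ (∀ q ∈ Q, π₁ q = 0) ∧
      π₀ (b 0) = 1 ∧ π₀ (b 1) = 0 ∧ π₁ (b 0) = 0 ∧ π₁ (b 1) = 1 ∧
      (∀ x ∈ P, x = π₀ x • (b 0 : W) + π₁ x • (b 1 : W)) ∧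
      ∀ R : Module.End ℂ W, Θ * R = R →
        R = (π₀ ∘ₗ R).smulRight (b 0 : W) + (π₁ ∘ₗ R).smulRight (b 1 : W) := by
  classical
  have hc := UnitaryFourTwo.isCompl_of_invol hΘΘ hP hQ
  have hcoord : ∀ (i j : Fin 2) , b.coord i (b j) = if j = i then 1 else 0 := fun i j => by
    change b.repr (b j) i = _
    rw [b.repr_self, Finsupp.single_apply]
  have hexp : ∀ x ∈ P, x = (b.coord 0 ∘ₗ P.projectionOnto Q hc) x • (b 0 : W) +
      (b.coord 1 ∘ₗ P.projectionOnto Q hc) x • (b 1 : W) := by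
    intro x hx
    have h := congrArg Subtype.val (b.sum_repr ⟨x, hx⟩)
    rw [Fin.sum_univ_two, Submodule.coe_add, Submodule.coe_smul, Submodule.coe_smul] at h
    rw [LinearMap.comp_apply, LinearMap.comp_apply, Submodule.projectionOnto_apply_of_mem_left hc hx]
    exact h.symm
  refine ⟨b.coord 0 ∘ₗ P.projectionOnto Q hc, b.coord 1 ∘ₗ P.projectionOnto Q hc, fun q hq => ?_, fun q hq => ?_,
    ?_, ?_, ?_, ?_, hexp, fun R hR => ?_⟩
  · rw [LinearMap.comp_apply, Submodule.projectionOnto_apply_of_mem_right hc hq, map_zero]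
  · rw [LinearMap.comp_apply, Submodule.projectionOnto_apply_of_mem_right hc hq, map_zero]
  · rw [LinearMap.comp_apply, Submodule.projectionOnto_apply_left hc, hcoord]; simp
  · rw [LinearMap.comp_apply, Submodule.projectionOnto_apply_left hc, hcoord]; simp
  · rw [LinearMap.comp_apply, Submodule.projectionOnto_apply_left hc, hcoord]; simp
  · rw [LinearMap.comp_apply, Submodule.projectionOnto_apply_left hc, hcoord]; simp
  · refine LinearMap.ext fun w => ?_
    have hRw : R w ∈ P := (hP _).2 (by rw [← Module.End.mul_apply, hR])
    rw [LinearMap.add_apply, LinearMap.smulRight_apply, LinearMap.smulRight_apply, LinearMap.comp_apply,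
      LinearMap.comp_apply]
    exact hexp (R w) hRw

/-- **Dimension count by duality**: if a subspace `S` of functionals has zero joint kernel inside `Q`, then
`dim Q ≤ dim S` (the evaluation map `Q → S^*` is injective). [cite: HoffmanKunze1971LinearAlgebra, §3.6–§3.7] -/
theorem UnitaryFourTwo.finrank_le_of_inf_dualCoannihilator_eq_bot [FiniteDimensional ℂ W]
    (S : Submodule ℂ (Module.Dual ℂ W)) (Q : Submodule ℂ W) (h : Q ⊓ S.dualCoannihilator = ⊥) :
    finrank ℂ Q ≤ finrank ℂ S := by
  let ev : Q →ₗ[ℂ] Module.Dual ℂ S := S.subtype.dualMap ∘ₗ (Module.Dual.eval ℂ W) ∘ₗ Q.subtype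
  have hev : ∀ (q : Q) (s : S), ev q s = (s : Module.Dual ℂ W) q := fun q s => rfl
  have hinj : Function.Injective ev := by
    refine (injective_iff_map_eq_zero ev).2 fun q hq => ?_
    have hmem : (q : W) ∈ Q ⊓ S.dualCoannihilator := by
      refine Submodule.mem_inf.2 ⟨q.2, (Submodule.mem_dualCoannihilator _).2 fun s hs => ?_⟩
      have h0 := LinearMap.congr_fun hq ⟨s, hs⟩
      rw [hev, LinearMap.zero_apply] at h0
      exact h0
    rw [h, Submodule.mem_bot] at hmem
    exact Subtype.ext hmem
  exact (LinearMap.finrank_le_finrank_of_injective hinj).trans_eq Subspace.dual_finrank_eq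

end Prelim

/-! ### §2 One rank-one raising operator `β₀ ⊗ p₀ ∈ 𝔊` gives all `β ⊗ p₀ ∈ 𝔊` -/

section Module

variable [FiniteDimensional ℂ W]

/-- **The `p₀`-family fills `P°`.** Let `𝔊` be bracket-closed, `Θ² = 1` with eigenspaces `P`, `Q`, and suppose `Q` has no
`𝔑`-stable subspace other than `0`, `Q` for the `P`-annihilator ideal `𝔑 = {X ∈ 𝔊 : XΘ = ΘX, X(P) = 0}`. If ONE rank-one
raising operator `β₀ ⊗ p₀` (`p₀ ∈ P`, `0 ≠ β₀ ∈ P°`) lies in `𝔊`, then `β ⊗ p₀ ∈ 𝔊` for EVERY `β ∈ P°`: the functionals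
`β ∈ P°` with `β ⊗ p₀ ∈ 𝔊` form a subspace `J` stable under `β ↦ β ∘ X` (`(β ⊗ p₀)·X = [β ⊗ p₀, X] ∈ 𝔊`,
`UnitaryThetaCore.raise_mul_mem`), its joint kernel in `Q` is `𝔑`-stable and `≠ Q`, hence `0`, so `dim J ≥ dim Q = dim P°`.
[cite: Ribet1983, Thm. 3] [cite: Humphreys1972, §19.1] [cite: HoffmanKunze1971LinearAlgebra, §3.7] -/
theorem UnitaryFourTwo.smulRight_mem_of_smulRight_mem {𝔊 : Submodule ℂ (Module.End ℂ W)}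
    (hbr : ∀ Y ∈ 𝔊, ∀ Z ∈ 𝔊, Y * Z - Z * Y ∈ 𝔊) {Θ : Module.End ℂ W} (hΘΘ : Θ * Θ = 1)
    {P Q : Submodule ℂ W} (hP : ∀ x, x ∈ P ↔ Θ x = x) (hQ : ∀ x, x ∈ Q ↔ Θ x = -x)
    (hNirr : ∀ U : Submodule ℂ W, U ≤ Q →
      (∀ X ∈ 𝔊, X * Θ = Θ * X → (∀ p ∈ P, X p = 0) → ∀ u ∈ U, X u ∈ U) → U = ⊥ ∨ U = Q)
    {p₀ : W} (hp₀ : p₀ ∈ P) {β₀ : Module.Dual ℂ W} (hβ₀P : β₀ ∈ P.dualAnnihilator) (hβ₀ : β₀ ≠ 0)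
    (hβ₀𝔊 : β₀.smulRight p₀ ∈ 𝔊) {β : Module.Dual ℂ W} (hβP : β ∈ P.dualAnnihilator) :
    β.smulRight p₀ ∈ 𝔊 := by
  classical
  -- the subspace `J` of functionals `β ∈ P°` with `β ⊗ p₀ ∈ 𝔊`
  let J : Submodule ℂ (Module.Dual ℂ W) :=
    { carrier := {β | β ∈ P.dualAnnihilator ∧ β.smulRight p₀ ∈ 𝔊}
      zero_mem' := ⟨Submodule.zero_mem _, by
        change (0 : Module.Dual ℂ W).smulRight p₀ ∈ 𝔊
        rw [UnitaryFourTwo.zero_smulRight]; exact Submodule.zero_mem _⟩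
      add_mem' := fun {a c} ha hc => ⟨Submodule.add_mem _ ha.1 hc.1, by
        rw [UnitaryFourTwo.add_smulRight]; exact Submodule.add_mem _ ha.2 hc.2⟩
      smul_mem' := fun c {a} ha => ⟨Submodule.smul_mem _ c ha.1, by
        rw [UnitaryFourTwo.smul_smulRight]; exact Submodule.smul_mem _ c ha.2⟩ }
  have hmemJ : ∀ β, β ∈ J ↔ β ∈ P.dualAnnihilator ∧ β.smulRight p₀ ∈ 𝔊 := fun β => Iff.rfl
  -- `J` is stable under precomposition with `𝔑`
  have hJX : ∀ X ∈ 𝔊, (∀ p ∈ P, X p = 0) → ∀ β ∈ J, β ∘ₗ X ∈ J := by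
    intro X hX hXP β hβ
    obtain ⟨hβP', hβ𝔊⟩ := (hmemJ β).1 hβ
    refine (hmemJ _).2 ⟨?_, ?_⟩
    · rw [Submodule.mem_dualAnnihilator]
      intro p hp
      rw [LinearMap.comp_apply, hXP p hp, map_zero]
    · rw [← UnitaryTwoOdd.smulRight_mul]
      obtain ⟨hΘB, -⟩ := UnitaryFourTwo.raise_smulRight hΘΘ hP hp₀
        (fun x hx => (Submodule.mem_dualAnnihilator β).1 hβP' x hx)
      exact (UnitaryThetaCore.raise_mul_mem hbr hΘΘ hP hX hXP hβ𝔊 hΘB).1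
  -- the joint kernel of `J` inside `Q` is `𝔑`-stable and not `Q`, hence `0`
  have hstab : ∀ X ∈ 𝔊, X * Θ = Θ * X → (∀ p ∈ P, X p = 0) →
      ∀ u ∈ Q ⊓ J.dualCoannihilator, X u ∈ Q ⊓ J.dualCoannihilator := by
    intro X hX hXΘ hXP u hu
    obtain ⟨huQ, huJ⟩ := Submodule.mem_inf.1 hu
    refine Submodule.mem_inf.2 ⟨(hQ _).2 ?_, ?_⟩
    · rw [← Module.End.mul_apply, ← hXΘ, Module.End.mul_apply, (hQ u).1 huQ, map_neg]
    · rw [Submodule.mem_dualCoannihilator]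
      intro β hβ
      have h := (Submodule.mem_dualCoannihilator u).1 huJ (β ∘ₗ X) (hJX X hX hXP β hβ)
      rwa [LinearMap.comp_apply] at h
  have hA : Q ⊓ J.dualCoannihilator = ⊥ := by
    rcases hNirr (Q ⊓ J.dualCoannihilator) inf_le_left hstab with h | h
    · exact h
    · exfalso
      apply hβ₀
      refine UnitaryFourTwo.dual_ext hΘΘ hP hQ (fun x hx => ?_) (fun x hx => ?_)
      · rw [LinearMap.zero_apply]; exact (Submodule.mem_dualAnnihilator β₀).1 hβ₀P x hx
      · rw [LinearMap.zero_apply]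
        have hx' : x ∈ Q ⊓ J.dualCoannihilator := by rw [h]; exact hx
        exact (Submodule.mem_dualCoannihilator x).1 (Submodule.mem_inf.1 hx').2 β₀ ((hmemJ β₀).2 ⟨hβ₀P, hβ₀𝔊⟩)
  -- dimension count: `J = P°`
  have hJle : J ≤ P.dualAnnihilator := fun β hβ => hβ.1
  have hle : finrank ℂ Q ≤ finrank ℂ J := UnitaryFourTwo.finrank_le_of_inf_dualCoannihilator_eq_bot J Q hA
  have hJeq : J = P.dualAnnihilator := by
    refine Submodule.eq_of_le_of_finrank_le hJle ?_
    have h1 := Subspace.finrank_add_finrank_dualAnnihilator_eq P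
    have h2 := UnitaryFourTwo.finrank_add_finrank hΘΘ hP hQ
    omega
  have hβJ : β ∈ J := by rw [hJeq]; exact hβP
  exact hβJ.2

/-! ### §3 A rank-one raising operator exists (`dim P = 2`) -/

/-- **Existence of a rank-one raising operator in `𝔊`** (`dim P = 2`, `Q ≠ 0`, `𝔊` irreducible, `Q` `𝔑`-irreducible).
Otherwise, with coordinates `π₀, π₁` on `P`, the maps `Φᵢ : B ↦ πᵢ ∘ B` on the raising part `𝔊₊` are injective (a `B` with
`π₀ ∘ B = 0` is the rank-one `(π₁ ∘ B) ⊗ b₁`); the joint kernel of `Φ₀(𝔊₊)` in `Q` is `𝔑`-stable (`B·X ∈ 𝔊₊`) and not `Q`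
(else `𝔊₊ = 0`, contradicting the covering fact `UnitaryThetaCore.mem_span_raise_apply`), so `Φ₀(𝔊₊) = P°` by dimension;
an eigenvector `β` of `Φ₁ ∘ Φ₀⁻¹` on `P°` gives `B = β ⊗ b₀ + cβ ⊗ b₁ = β ⊗ (b₀ + c b₁)` of rank one — contradiction.
[cite: Ribet1983, Thm. 3] [cite: Gordon1997, §6 (proof of Thm. 6.3.3, p. 19)] [cite: Humphreys1972, §19.1]
[cite: HoffmanKunze1971LinearAlgebra, §3.7] -/
theorem UnitaryFourTwo.exists_smulRight_mem {𝔊 : Submodule ℂ (Module.End ℂ W)}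
    (hbr : ∀ Y ∈ 𝔊, ∀ Z ∈ 𝔊, Y * Z - Z * Y ∈ 𝔊)
    (hirr : ∀ U : Submodule ℂ W, (∀ A ∈ 𝔊, ∀ u ∈ U, A u ∈ U) → U = ⊥ ∨ U = ⊤)
    {Θ : Module.End ℂ W} (hΘ : Θ ∈ 𝔊) (hΘΘ : Θ * Θ = 1)
    {P Q : Submodule ℂ W} (hP : ∀ x, x ∈ P ↔ Θ x = x) (hQ : ∀ x, x ∈ Q ↔ Θ x = -x)
    (hP2 : finrank ℂ P = 2) (hQpos : 0 < finrank ℂ Q)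
    (hNirr : ∀ U : Submodule ℂ W, U ≤ Q →
      (∀ X ∈ 𝔊, X * Θ = Θ * X → (∀ p ∈ P, X p = 0) → ∀ u ∈ U, X u ∈ U) → U = ⊥ ∨ U = Q) :
    ∃ p₀ ∈ P, p₀ ≠ 0 ∧ ∃ β₀ ∈ P.dualAnnihilator, β₀ ≠ 0 ∧ β₀.smulRight p₀ ∈ 𝔊 := by
  classical
  -- coordinates on `P`
  let b : Module.Basis (Fin 2) ℂ P := Module.finBasisOfFinrankEq ℂ P hP2
  obtain ⟨π₀, π₁, hπ₀Q, hπ₁Q, h00, h01, h10, h11, hexp, hRexp⟩ := UnitaryFourTwo.exists_coords hΘΘ hP hQ b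
  have hb0 : (b 0 : W) ≠ 0 := fun h => b.ne_zero 0 (Subtype.ext h)
  have hb1 : (b 1 : W) ≠ 0 := fun h => b.ne_zero 1 (Subtype.ext h)
  have hQ0 : ∃ q : W, q ≠ 0 ∧ Θ q = -q := by
    obtain ⟨⟨q, hq⟩, hq0⟩ := Module.finrank_pos_iff_exists_ne_zero.1 hQpos
    exact ⟨q, fun h => hq0 (Subtype.ext h), (hQ q).1 hq⟩
  by_contra hnone
  push Not at hnone
  -- the raising part `V = 𝔊₊`
  let V : Submodule ℂ (Module.End ℂ W) :=
    { carrier := {B | B ∈ 𝔊 ∧ Θ * B = B ∧ B * Θ = -B}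
      zero_mem' := ⟨Submodule.zero_mem _, by rw [mul_zero], by rw [zero_mul, neg_zero]⟩
      add_mem' := fun {a c} ha hc => ⟨Submodule.add_mem _ ha.1 hc.1, by rw [mul_add, ha.2.1, hc.2.1], by
        rw [add_mul, ha.2.2, hc.2.2, neg_add]⟩
      smul_mem' := fun c {a} ha => ⟨Submodule.smul_mem _ c ha.1, by rw [mul_smul_comm, ha.2.1], by
        rw [smul_mul_assoc, ha.2.2, smul_neg]⟩ }
  have hmemV : ∀ B, B ∈ V ↔ B ∈ 𝔊 ∧ Θ * B = B ∧ B * Θ = -B := fun B => Iff.rfl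
  -- the coordinate maps `Φᵢ : B ↦ πᵢ ∘ B`
  let Φ₀ : V →ₗ[ℂ] Module.Dual ℂ W := (LinearMap.llcomp ℂ W W ℂ π₀) ∘ₗ V.subtype
  let Φ₁ : V →ₗ[ℂ] Module.Dual ℂ W := (LinearMap.llcomp ℂ W W ℂ π₁) ∘ₗ V.subtype
  have hΦ₀ : ∀ B : V, Φ₀ B = π₀ ∘ₗ (B : Module.End ℂ W) := fun B => rfl
  have hΦ₁ : ∀ B : V, Φ₁ B = π₁ ∘ₗ (B : Module.End ℂ W) := fun B => rfl
  have hann : ∀ (B : V) (π : Module.Dual ℂ W), π ∘ₗ (B : Module.End ℂ W) ∈ P.dualAnnihilator := fun B π =>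
    UnitaryFourTwo.comp_mem_dualAnnihilator B.2.2.2 hP π
  -- `Φ₀` is injective (no rank-one operator)
  have hΦ₀inj : Function.Injective Φ₀ := by
    refine (injective_iff_map_eq_zero Φ₀).2 fun B hB => ?_
    have h := hRexp B B.2.2.1
    have h0 : π₀ ∘ₗ (B : Module.End ℂ W) = 0 := hB
    rw [h0, UnitaryFourTwo.zero_smulRight, zero_add] at h
    by_cases hβ : π₁ ∘ₗ (B : Module.End ℂ W) = 0
    · rw [hβ, UnitaryFourTwo.zero_smulRight] at h
      exact Subtype.ext h
    · exfalso
      have hB𝔊 : (π₁ ∘ₗ (B : Module.End ℂ W)).smulRight (b 1 : W) ∈ 𝔊 := by rw [← h]; exact B.2.1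
      exact hnone _ (b 1).2 hb1 _ (hann B π₁) hβ hB𝔊
  -- the range of `Φ₀` is `P°`
  have hS : LinearMap.range Φ₀ = P.dualAnnihilator := by
    have hle : LinearMap.range Φ₀ ≤ P.dualAnnihilator := by
      rintro _ ⟨B, rfl⟩
      exact hann B π₀
    refine Submodule.eq_of_le_of_finrank_le hle ?_
    have hstab : ∀ X ∈ 𝔊, X * Θ = Θ * X → (∀ p ∈ P, X p = 0) →
        ∀ u ∈ Q ⊓ (LinearMap.range Φ₀).dualCoannihilator, X u ∈ Q ⊓ (LinearMap.range Φ₀).dualCoannihilator := by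
      intro X hX hXΘ hXP u hu
      obtain ⟨huQ, huS⟩ := Submodule.mem_inf.1 hu
      refine Submodule.mem_inf.2 ⟨(hQ _).2 ?_, ?_⟩
      · rw [← Module.End.mul_apply, ← hXΘ, Module.End.mul_apply, (hQ u).1 huQ, map_neg]
      · rw [Submodule.mem_dualCoannihilator]
        rintro _ ⟨B, rfl⟩
        obtain ⟨hBX, hΘBX, hBXΘ⟩ := UnitaryThetaCore.raise_mul_mem hbr hΘΘ hP hX hXP B.2.1 B.2.2.1
        have h := (Submodule.mem_dualCoannihilator u).1 huS _
          (LinearMap.mem_range_self Φ₀ ⟨(B : Module.End ℂ W) * X, hBX, hΘBX, hBXΘ⟩)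
        rw [hΦ₀, LinearMap.comp_apply]
        rw [hΦ₀, LinearMap.comp_apply] at h
        exact h
    have hA : Q ⊓ (LinearMap.range Φ₀).dualCoannihilator = ⊥ := by
      rcases hNirr _ inf_le_left hstab with h | h
      · exact h
      · exfalso
        -- every `B ∈ V` has `π₀ ∘ B = 0`, hence `B = 0`; so `V = 0`, against the covering fact
        have hV0 : ∀ B : V, B = 0 := fun B => by
          apply hΦ₀inj
          rw [map_zero, hΦ₀]
          refine UnitaryFourTwo.dual_ext hΘΘ hP hQ (fun x hx => ?_) (fun x hx => ?_)
          · rw [LinearMap.zero_apply]; exact (Submodule.mem_dualAnnihilator _).1 (hann B π₀) x hx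
          · rw [LinearMap.zero_apply]
            have hx' : x ∈ Q ⊓ (LinearMap.range Φ₀).dualCoannihilator := by rw [h]; exact hx
            exact (Submodule.mem_dualCoannihilator x).1 (Submodule.mem_inf.1 hx').2 _
              (LinearMap.mem_range_self Φ₀ B)
        have hspan := UnitaryThetaCore.mem_span_raise_apply hbr hirr hΘ hΘΘ hQ0 ((hP _).1 (b 0).2)
        have hbot : Submodule.span ℂ {x : W | ∃ B ∈ 𝔊, Θ * B = B ∧ B * Θ = -B ∧ ∃ w, B w = x} = ⊥ := by
          rw [Submodule.span_eq_bot]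
          rintro x ⟨B, hB, hΘB, hBΘ, w, rfl⟩
          have hB0 : B = 0 := congrArg Subtype.val (hV0 ⟨B, hB, hΘB, hBΘ⟩)
          rw [hB0, LinearMap.zero_apply]
        rw [hbot, Submodule.mem_bot] at hspan
        exact hb0 hspan
    have h1 := UnitaryFourTwo.finrank_le_of_inf_dualCoannihilator_eq_bot _ Q hA
    have h2 := Subspace.finrank_add_finrank_dualAnnihilator_eq P
    have h3 := UnitaryFourTwo.finrank_add_finrank hΘΘ hP hQ
    omega
  -- the equivalence `e : V ≃ P°` induced by `Φ₀`, and `θ = Φ₁ ∘ e⁻¹` on `P°`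
  have hΦ₀mem : ∀ B : V, Φ₀ B ∈ P.dualAnnihilator := fun B => hann B π₀
  have hΦ₁mem : ∀ B : V, Φ₁ B ∈ P.dualAnnihilator := fun B => hann B π₁
  let f₀ : V →ₗ[ℂ] P.dualAnnihilator := Φ₀.codRestrict _ hΦ₀mem
  have hf₀bij : Function.Bijective f₀ := by
    refine ⟨fun a c h => hΦ₀inj (congrArg Subtype.val h), fun φ => ?_⟩
    have hφ : (φ : Module.Dual ℂ W) ∈ LinearMap.range Φ₀ := by rw [hS]; exact φ.2
    obtain ⟨B, hB⟩ := hφ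
    exact ⟨B, Subtype.ext hB⟩
  let e : V ≃ₗ[ℂ] P.dualAnnihilator := LinearEquiv.ofBijective f₀ hf₀bij
  let θ : Module.End ℂ P.dualAnnihilator := (Φ₁.codRestrict _ hΦ₁mem) ∘ₗ e.symm.toLinearMap
  haveI : Nontrivial P.dualAnnihilator := by
    apply Module.nontrivial_of_finrank_pos (R := ℂ)
    have h2 := Subspace.finrank_add_finrank_dualAnnihilator_eq P
    have h3 := UnitaryFourTwo.finrank_add_finrank hΘΘ hP hQ
    omega
  obtain ⟨c, hc⟩ := Module.End.exists_eigenvalue θ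
  obtain ⟨β, hβ⟩ := hc.exists_hasEigenvector
  have hθβ : θ β = c • β := hβ.apply_eq_smul
  have hβ0 : β ≠ 0 := hβ.2
  set B : V := e.symm β with hBdef
  have he0 : Φ₀ B = (β : Module.Dual ℂ W) := by
    have h := congrArg Subtype.val (e.apply_symm_apply β)
    rw [LinearEquiv.ofBijective_apply, LinearMap.codRestrict_apply] at h
    exact h
  have he1 : Φ₁ B = c • (β : Module.Dual ℂ W) := by
    have h := congrArg Subtype.val hθβ
    rw [Submodule.coe_smul, LinearMap.comp_apply, LinearMap.codRestrict_apply] at h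
    exact h
  -- `B = β ⊗ (b 0 + c·b 1)`, a rank-one raising operator in `𝔊`
  have hBeq : (B : Module.End ℂ W) = (β : Module.Dual ℂ W).smulRight ((b 0 : W) + c • (b 1 : W)) := by
    have h := hRexp B B.2.2.1
    rw [UnitaryFourTwo.smulRight_add, UnitaryFourTwo.smulRight_smul]
    rw [← hΦ₀ B, ← hΦ₁ B, he0, he1, UnitaryFourTwo.smul_smulRight] at h
    exact h
  have hmem : (b 0 : W) + c • (b 1 : W) ∈ P := Submodule.add_mem _ (b 0).2 (Submodule.smul_mem _ c (b 1).2)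
  have hne : (b 0 : W) + c • (b 1 : W) ≠ 0 := by
    intro h0
    have h := congrArg π₀ h0
    rw [map_add, map_smul, h00, h01, smul_zero, add_zero, map_zero] at h
    exact one_ne_zero h
  have hB𝔊 : (β : Module.Dual ℂ W).smulRight ((b 0 : W) + c • (b 1 : W)) ∈ 𝔊 := by rw [← hBeq]; exact B.2.1
  exact hnone _ hmem hne β β.2 (fun h => hβ0 (Subtype.ext h)) hB𝔊

/-! ### §4 Every raising operator lies in `𝔊` -/

/-- **`𝔊₊ = Hom(Q, P)`**: under the hypotheses of §3, EVERY raising operator (`ΘR = R = −RΘ`) lies in `𝔊`. From §3 a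
rank-one `β₀ ⊗ p₀ ∈ 𝔊`; by §2 all `β ⊗ p₀`, `β ∈ P°`; the covering fact moves the vector: some raising `B ∈ 𝔊` has
`B = (π₀∘B) ⊗ p₀ + (π₁∘B) ⊗ p₀′` with `π₁ ∘ B ≠ 0` (`p₀, p₀′` a basis of `P`), so `(π₁∘B) ⊗ p₀′ ∈ 𝔊` and §2 again.
[cite: Ribet1983, Thm. 3] [cite: Gordon1997, §6 (proof of Thm. 6.3.3, p. 19)] [cite: Humphreys1972, §19.1] -/
theorem UnitaryFourTwo.raise_mem_of_annP_irreducible {𝔊 : Submodule ℂ (Module.End ℂ W)}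
    (hbr : ∀ Y ∈ 𝔊, ∀ Z ∈ 𝔊, Y * Z - Z * Y ∈ 𝔊)
    (hirr : ∀ U : Submodule ℂ W, (∀ A ∈ 𝔊, ∀ u ∈ U, A u ∈ U) → U = ⊥ ∨ U = ⊤)
    {Θ : Module.End ℂ W} (hΘ : Θ ∈ 𝔊) (hΘΘ : Θ * Θ = 1)
    {P Q : Submodule ℂ W} (hP : ∀ x, x ∈ P ↔ Θ x = x) (hQ : ∀ x, x ∈ Q ↔ Θ x = -x)
    (hP2 : finrank ℂ P = 2) (hQpos : 0 < finrank ℂ Q)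
    (hNirr : ∀ U : Submodule ℂ W, U ≤ Q →
      (∀ X ∈ 𝔊, X * Θ = Θ * X → (∀ p ∈ P, X p = 0) → ∀ u ∈ U, X u ∈ U) → U = ⊥ ∨ U = Q)
    {R : Module.End ℂ W} (hΘR : Θ * R = R) (hRΘ : R * Θ = -R) : R ∈ 𝔊 := by
  classical
  obtain ⟨p₀, hp₀P, hp₀0, β₀, hβ₀P, hβ₀0, hβ₀𝔊⟩ :=
    UnitaryFourTwo.exists_smulRight_mem hbr hirr hΘ hΘΘ hP hQ hP2 hQpos hNirr
  have hall₀ : ∀ β ∈ P.dualAnnihilator, β.smulRight p₀ ∈ 𝔊 := fun β hβ =>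
    UnitaryFourTwo.smulRight_mem_of_smulRight_mem hbr hΘΘ hP hQ hNirr hp₀P hβ₀P hβ₀0 hβ₀𝔊 hβ
  have hQ0 : ∃ q : W, q ≠ 0 ∧ Θ q = -q := by
    obtain ⟨⟨q, hq⟩, hq0⟩ := Module.finrank_pos_iff_exists_ne_zero.1 hQpos
    exact ⟨q, fun h => hq0 (Subtype.ext h), (hQ q).1 hq⟩
  -- extend `p₀` to a basis `p₀, x` of `P`
  obtain ⟨x, hxP, hx⟩ : ∃ x ∈ P, x ∉ (ℂ ∙ p₀) := by
    by_contra hno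
    push Not at hno
    have hle : P ≤ ℂ ∙ p₀ := fun y hy => hno y hy
    have h1 : finrank ℂ (ℂ ∙ p₀) = 1 := finrank_span_singleton hp₀0
    have h2 := Submodule.finrank_mono hle
    omega
  have hli : LinearIndependent ℂ ![(⟨p₀, hp₀P⟩ : P), ⟨x, hxP⟩] := by
    refine LinearIndependent.pair_iff.2 fun s t hst => ?_
    have hst' : s • p₀ + t • x = 0 := by
      have h := congrArg Subtype.val hst
      simpa using h
    by_cases ht : t = 0
    · rw [ht, zero_smul, add_zero] at hst'
      exact ⟨(smul_eq_zero.1 hst').resolve_right hp₀0, ht⟩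
    · exfalso
      apply hx
      have h2 : t • x = -(s • p₀) := eq_neg_of_add_eq_zero_right hst'
      have hxeq : x = (-(t⁻¹ * s)) • p₀ := by
        calc x = t⁻¹ • (t • x) := by rw [smul_smul, inv_mul_cancel₀ ht, one_smul]
          _ = (-(t⁻¹ * s)) • p₀ := by rw [h2, smul_neg, smul_smul, neg_smul]
      rw [hxeq]
      exact Submodule.smul_mem _ _ (Submodule.mem_span_singleton_self p₀)
  have hcard : Fintype.card (Fin 2) = finrank ℂ P := by rw [Fintype.card_fin, hP2]
  let b : Module.Basis (Fin 2) ℂ P := basisOfLinearIndependentOfCardEqFinrank hli hcard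
  have hb : ⇑b = ![(⟨p₀, hp₀P⟩ : P), ⟨x, hxP⟩] := coe_basisOfLinearIndependentOfCardEqFinrank hli hcard
  have hb0 : (b 0 : W) = p₀ := by rw [hb]; rfl
  obtain ⟨π₀, π₁, hπ₀Q, hπ₁Q, h00, h01, h10, h11, hexp, hRexp⟩ := UnitaryFourTwo.exists_coords hΘΘ hP hQ b
  -- some raising `B ∈ 𝔊` with `π₁ ∘ B ≠ 0` (covering)
  obtain ⟨B, hB, hΘB, hBΘ, hB1⟩ : ∃ B ∈ 𝔊, Θ * B = B ∧ B * Θ = -B ∧ π₁ ∘ₗ B ≠ 0 := by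
    by_contra hno
    push Not at hno
    have hspan := UnitaryThetaCore.mem_span_raise_apply hbr hirr hΘ hΘΘ hQ0 ((hP _).1 (b 1).2)
    have hle : Submodule.span ℂ {x : W | ∃ B ∈ 𝔊, Θ * B = B ∧ B * Θ = -B ∧ ∃ w, B w = x} ≤
        LinearMap.ker π₁ := by
      rw [Submodule.span_le]
      rintro _ ⟨B, hB, hΘB, hBΘ, w, rfl⟩
      rw [SetLike.mem_coe, LinearMap.mem_ker]
      have h := LinearMap.congr_fun (hno B hB hΘB hBΘ) w
      rw [LinearMap.comp_apply, LinearMap.zero_apply] at h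
      exact h
    have h := hle hspan
    rw [LinearMap.mem_ker, h11] at h
    exact one_ne_zero h
  -- decompose `B` along the basis
  have hBexp := hRexp B hΘB
  have hfirst : (π₀ ∘ₗ B).smulRight (b 0 : W) ∈ 𝔊 := by
    rw [hb0]; exact hall₀ _ (UnitaryFourTwo.comp_mem_dualAnnihilator hBΘ hP π₀)
  have hsecond : (π₁ ∘ₗ B).smulRight (b 1 : W) ∈ 𝔊 := by
    have h : (π₁ ∘ₗ B).smulRight (b 1 : W) = B - (π₀ ∘ₗ B).smulRight (b 0 : W) := by
      rw [eq_sub_iff_add_eq, add_comm, ← hBexp]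
    rw [h]
    exact Submodule.sub_mem _ hB hfirst
  have hall₁ : ∀ β ∈ P.dualAnnihilator, β.smulRight (b 1 : W) ∈ 𝔊 := fun β hβ =>
    UnitaryFourTwo.smulRight_mem_of_smulRight_mem hbr hΘΘ hP hQ hNirr (b 1).2
      (UnitaryFourTwo.comp_mem_dualAnnihilator hBΘ hP π₁) hB1 hsecond hβ
  -- conclude
  rw [hRexp R hΘR, hb0]
  exact Submodule.add_mem _ (hall₀ _ (UnitaryFourTwo.comp_mem_dualAnnihilator hRΘ hP π₀))
    (hall₁ _ (UnitaryFourTwo.comp_mem_dualAnnihilator hRΘ hP π₁))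

/-! ### §5 The theorem -/

/-- **THE `Θ`-SUBALGEBRA THEOREM WITH AN IRREDUCIBLE `P`-ANNIHILATOR IDEAL.** Let `𝔊 ⊆ End(W)` be closed under the
commutator, act irreducibly, and contain `1` and an involution `Θ` with eigenspaces `P` (`dim P = 2`) and `Q` (`dim Q ≥ 2`).
If `Q` has no subspace other than `0` and `Q` stable under all `X ∈ 𝔊` commuting with `Θ` and killing `P` (the
`P`-annihilator ideal `𝔑` of the Levi part), then `𝔊 = End(W)`. Proof: §4 gives all raising operators; for the injective
lowering `C` of `UnitaryThetaCore.exists_lower_injOn` and `β ∈ P°`, `p ∈ P`: `[[β ⊗ p, C], C] = −2·(βC) ⊗ (Cp) ∈ 𝔊`,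
`[β ⊗ p′, (βC) ⊗ (Cp)] = β(Cp)·(βC) ⊗ p′ − β(Cp′)·(β ⊗ Cp)`; choosing `β, β′ ∈ P°` dual to `Cp, Cp′` (so that
`βC = π₀`, `β′C = π₁` are the coordinates of the basis `p, p′`) this yields `π₀ ⊗ p′, π₁ ⊗ p ∈ 𝔊`, their bracket
`π₀ ⊗ p − π₁ ⊗ p′`, and with `π_P = ½(1 + Θ) = π₀ ⊗ p + π₁ ⊗ p′ ∈ 𝔊` the rank-one idempotent `π₀ ⊗ p ∈ 𝔊`;
`UnitaryTwoOdd.eq_top_of_rankOne` concludes. For `(dim P, dim Q) = (2, 4)` this is the `⊤` branch of the cell's crux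
`UnitaryThetaCore.top_or_radical_two_four`; the `𝔑`-REDUCIBLE case is the tensor skeleton (sequel).
[cite: Ribet1983, Thm. 3] [cite: Gordon1997, Thm. 6.3 (3) and pp. 18–19] [cite: MoonenZarhin1999LowDim, §2 (2.5), Thm. (2.7)]
[cite: Tankeev1996, Introduction] [cite: Humphreys1972, §19.1] -/
theorem UnitaryFourTwo.eq_top_of_annP_irreducible {𝔊 : Submodule ℂ (Module.End ℂ W)}
    (hbr : ∀ Y ∈ 𝔊, ∀ Z ∈ 𝔊, Y * Z - Z * Y ∈ 𝔊) (h1 : (1 : Module.End ℂ W) ∈ 𝔊)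
    (hirr : ∀ U : Submodule ℂ W, (∀ A ∈ 𝔊, ∀ u ∈ U, A u ∈ U) → U = ⊥ ∨ U = ⊤)
    {Θ : Module.End ℂ W} (hΘ : Θ ∈ 𝔊) (hΘΘ : Θ * Θ = 1)
    {P Q : Submodule ℂ W} (hP : ∀ x, x ∈ P ↔ Θ x = x) (hQ : ∀ x, x ∈ Q ↔ Θ x = -x)
    (hP2 : finrank ℂ P = 2) (hQ2 : 2 ≤ finrank ℂ Q)
    (hNirr : ∀ U : Submodule ℂ W, U ≤ Q →
      (∀ X ∈ 𝔊, X * Θ = Θ * X → (∀ p ∈ P, X p = 0) → ∀ u ∈ U, X u ∈ U) → U = ⊥ ∨ U = Q) :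
    𝔊 = ⊤ := by
  classical
  have hΘΘv : ∀ v, Θ (Θ v) = v := fun v => by rw [← Module.End.mul_apply, hΘΘ, Module.End.one_apply]
  have hQpos : 0 < finrank ℂ Q := by omega
  have hraise : ∀ R : Module.End ℂ W, Θ * R = R → R * Θ = -R → R ∈ 𝔊 := fun R hR1 hR2 =>
    UnitaryFourTwo.raise_mem_of_annP_irreducible hbr hirr hΘ hΘΘ hP hQ hP2 hQpos hNirr hR1 hR2
  -- an injective lowering operator
  obtain ⟨C, hC, hΘC, hCΘ, hCinj⟩ := UnitaryThetaCore.exists_lower_injOn hbr hirr hΘ hΘΘ hP hQ hP2 hQ2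
  have hCC : C * C = 0 := UnitaryThetaCore.mul_self_eq_zero_of_lower hΘC hCΘ
  have hCCv : ∀ w, C (C w) = 0 := fun w => by rw [← Module.End.mul_apply, hCC, LinearMap.zero_apply]
  have hCmem : ∀ w, C w ∈ Q := fun w => (hQ _).2 (by rw [← Module.End.mul_apply, hΘC, LinearMap.neg_apply])
  have hCQ : ∀ q ∈ Q, C q = 0 := fun q hq => by
    have h : C q = -(C q) := by
      conv_lhs => rw [← neg_neg q, ← (hQ q).1 hq, map_neg, ← Module.End.mul_apply, hCΘ]
    have h2 : (2 : ℂ) • C q = 0 := by rw [two_smul]; nth_rewrite 2 [h]; rw [add_neg_cancel]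
    exact (smul_eq_zero.1 h2).resolve_left two_ne_zero
  have hc := UnitaryFourTwo.isCompl_of_invol hΘΘ hP hQ
  -- a basis `p, p'` of `P` and its coordinates
  let b : Module.Basis (Fin 2) ℂ P := Module.finBasisOfFinrankEq ℂ P hP2
  obtain ⟨π₀, π₁, hπ₀Q, hπ₁Q, h00, h01, h10, h11, hexp, -⟩ := UnitaryFourTwo.exists_coords hΘΘ hP hQ b
  set p : W := (b 0 : W) with hpdef
  set p' : W := (b 1 : W) with hp'def
  have hp : p ∈ P := (b 0).2
  have hp' : p' ∈ P := (b 1).2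
  -- `Cu ∉ P ⊔ ℂ·Cv` for independent `u, v ∈ P`
  have key : ∀ {u v : W}, u ∈ P → v ∈ P → (∀ t : ℂ, u ≠ t • v) → C u ∉ P ⊔ (ℂ ∙ C v) := by
    intro u v hu hv hne hmem
    obtain ⟨y, hy, z, hz, hyz⟩ := Submodule.mem_sup.1 hmem
    obtain ⟨t, rfl⟩ := Submodule.mem_span_singleton.1 hz
    have hyeq : y = C (u - t • v) := by rw [map_sub, map_smul, ← hyz, add_sub_cancel_right]
    have hyQ : y ∈ Q := by rw [hyeq]; exact hCmem _
    have hy0 : y = 0 := by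
      have h : y ∈ P ⊓ Q := Submodule.mem_inf.2 ⟨hy, hyQ⟩
      rwa [hc.inf_eq_bot, Submodule.mem_bot] at h
    rw [hy0] at hyeq
    have h := hCinj _ (Submodule.sub_mem _ hu (Submodule.smul_mem _ t hv)) hyeq.symm
    exact hne t (sub_eq_zero.1 h)
  have hpp' : ∀ t : ℂ, p ≠ t • p' := fun t h => by
    have h' := congrArg π₀ h
    rw [h00, map_smul, h01, smul_zero] at h'
    exact one_ne_zero h'
  have hp'p : ∀ t : ℂ, p' ≠ t • p := fun t h => by
    have h' := congrArg π₁ h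
    rw [h11, map_smul, h10, smul_zero] at h'
    exact one_ne_zero h'
  -- functionals `β, β' ∈ P°` dual to `Cp, Cp'`
  have hdual : ∀ {u v : W}, u ∈ P → v ∈ P → (∀ t : ℂ, u ≠ t • v) →
      ∃ β : Module.Dual ℂ W, (∀ y ∈ P, β y = 0) ∧ β (C u) = 1 ∧ β (C v) = 0 := by
    intro u v hu hv hne
    obtain ⟨f, hf1, hf0⟩ := Submodule.exists_dual_map_eq_bot_of_notMem (key hu hv hne) inferInstance
    have hf : ∀ y ∈ P ⊔ (ℂ ∙ C v), f y = 0 := fun y hy => by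
      have hmem : f y ∈ Submodule.map f (P ⊔ (ℂ ∙ C v)) := Submodule.mem_map_of_mem hy
      rw [hf0, Submodule.mem_bot] at hmem
      exact hmem
    refine ⟨(f (C u))⁻¹ • f, fun y hy => ?_, ?_, ?_⟩
    · rw [LinearMap.smul_apply, hf y (Submodule.mem_sup_left hy), smul_zero]
    · rw [LinearMap.smul_apply, smul_eq_mul, inv_mul_cancel₀ hf1]
    · rw [LinearMap.smul_apply, hf _ (Submodule.mem_sup_right (Submodule.mem_span_singleton_self _)), smul_zero]
  obtain ⟨β, hβP, hβ1, hβ0⟩ := hdual hp hp' hpp'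
  obtain ⟨β', hβ'P, hβ'1, hβ'0⟩ := hdual hp' hp hp'p
  -- `β ∘ C = π₀`, `β' ∘ C = π₁`
  have hγ : β ∘ₗ C = π₀ := by
    refine UnitaryFourTwo.dual_ext hΘΘ hP hQ (fun y hy => ?_) (fun y hy => ?_)
    · rw [LinearMap.comp_apply]
      conv_lhs => rw [hexp y hy]
      rw [map_add, map_smul, map_smul, map_add, map_smul, map_smul, hβ1, hβ0, smul_zero, add_zero, smul_eq_mul,
        mul_one]
    · rw [LinearMap.comp_apply, hCQ y hy, map_zero, hπ₀Q y hy]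
  have hγ' : β' ∘ₗ C = π₁ := by
    refine UnitaryFourTwo.dual_ext hΘΘ hP hQ (fun y hy => ?_) (fun y hy => ?_)
    · rw [LinearMap.comp_apply]
      conv_lhs => rw [hexp y hy]
      rw [map_add, map_smul, map_smul, map_add, map_smul, map_smul, hβ'1, hβ'0, smul_zero, zero_add, smul_eq_mul,
        mul_one]
    · rw [LinearMap.comp_apply, hCQ y hy, map_zero, hπ₁Q y hy]
  -- Step 1: `(δC) ⊗ (Cu) ∈ 𝔊` for `δ ∈ P°`, `u ∈ P` (`[[δ ⊗ u, C], C] = −2·(δC) ⊗ Cu`)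
  have hL : ∀ {δ : Module.Dual ℂ W} {u : W}, u ∈ P → (∀ y ∈ P, δ y = 0) →
      (δ ∘ₗ C).smulRight (C u) ∈ 𝔊 := by
    intro δ u hu hδP
    obtain ⟨hΘX, hXΘ⟩ := UnitaryFourTwo.raise_smulRight hΘΘ hP hu hδP
    have hX : δ.smulRight u ∈ 𝔊 := hraise _ hΘX hXΘ
    have h1' := hbr _ hX _ hC
    have h2 := hbr _ h1' _ hC
    have hcomp : (δ.smulRight u * C - C * δ.smulRight u) * C - C * (δ.smulRight u * C - C * δ.smulRight u) =
        -((2 : ℂ) • (δ ∘ₗ C).smulRight (C u)) := by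
      refine LinearMap.ext fun w => ?_
      simp only [LinearMap.sub_apply, Module.End.mul_apply, LinearMap.smulRight_apply, LinearMap.comp_apply,
        map_smul, map_sub, LinearMap.neg_apply, LinearMap.smul_apply, hCCv, map_zero, smul_zero]
      module
    rw [hcomp] at h2
    have h3 := Submodule.smul_mem 𝔊 (-(2 : ℂ)⁻¹) h2
    have h4 : (-(2 : ℂ)⁻¹) • -((2 : ℂ) • (δ ∘ₗ C).smulRight (C u)) = (δ ∘ₗ C).smulRight (C u) := by
      rw [smul_neg, neg_smul, neg_neg, smul_smul, inv_mul_cancel₀ two_ne_zero, one_smul]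
    rwa [h4] at h3
  -- Step 2: `(δC) ⊗ v ∈ 𝔊` when `δ(Cu) = 1`, `δ(Cv) = 0` (`[δ ⊗ v, (δC) ⊗ Cu] = (δC) ⊗ v`)
  have hN : ∀ {δ : Module.Dual ℂ W} {u v : W}, u ∈ P → v ∈ P → (∀ y ∈ P, δ y = 0) → δ (C u) = 1 →
      δ (C v) = 0 → (δ ∘ₗ C).smulRight v ∈ 𝔊 := by
    intro δ u v hu hv hδP hδu hδv
    obtain ⟨hΘX, hXΘ⟩ := UnitaryFourTwo.raise_smulRight hΘΘ hP hv hδP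
    have hX : δ.smulRight v ∈ 𝔊 := hraise _ hΘX hXΘ
    have h := hbr _ hX _ (hL hu hδP)
    rw [UnitaryTwoOdd.smulRight_comm_smulRight, hδu, one_smul, LinearMap.comp_apply, hδv, zero_smul,
      sub_zero] at h
    exact h
  have hN₁ : π₀.smulRight p' ∈ 𝔊 := by rw [← hγ]; exact hN hp hp' hβP hβ1 hβ0
  have hN₂ : π₁.smulRight p ∈ 𝔊 := by rw [← hγ']; exact hN hp' hp hβ'P hβ'1 hβ'0
  -- Step 3: `H = [π₁ ⊗ p, π₀ ⊗ p'] = π₀ ⊗ p − π₁ ⊗ p' ∈ 𝔊`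
  have hH : π₀.smulRight p - π₁.smulRight p' ∈ 𝔊 := by
    have h := hbr _ hN₂ _ hN₁
    rw [UnitaryTwoOdd.smulRight_comm_smulRight, h11, one_smul, h00, one_smul] at h
    exact h
  -- Step 4: `π_P = ½(1 + Θ) = π₀ ⊗ p + π₁ ⊗ p' ∈ 𝔊`
  have hπP : (2 : ℂ)⁻¹ • ((1 : Module.End ℂ W) + Θ) = π₀.smulRight p + π₁.smulRight p' := by
    refine UnitaryFourTwo.end_ext hΘΘ hP hQ (fun y hy => ?_) (fun y hy => ?_)
    · rw [LinearMap.smul_apply, LinearMap.add_apply, Module.End.one_apply, (hP y).1 hy, LinearMap.add_apply,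
        LinearMap.smulRight_apply, LinearMap.smulRight_apply, ← hexp y hy, ← two_smul ℂ y, smul_smul,
        inv_mul_cancel₀ two_ne_zero, one_smul]
    · rw [LinearMap.smul_apply, LinearMap.add_apply, Module.End.one_apply, (hQ y).1 hy, add_neg_cancel, smul_zero,
        LinearMap.add_apply, LinearMap.smulRight_apply, LinearMap.smulRight_apply, hπ₀Q y hy, hπ₁Q y hy, zero_smul,
        zero_smul, add_zero]
  have hπP𝔊 : (2 : ℂ)⁻¹ • ((1 : Module.End ℂ W) + Θ) ∈ 𝔊 := Submodule.smul_mem _ _ (Submodule.add_mem _ h1 hΘ)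
  -- Step 5: the rank-one idempotent `π₀ ⊗ p = ½(H + π_P) ∈ 𝔊`
  have he : π₀.smulRight p ∈ 𝔊 := by
    have h := Submodule.smul_mem 𝔊 (2 : ℂ)⁻¹ (Submodule.add_mem _ hH hπP𝔊)
    rw [hπP] at h
    have h' : (2 : ℂ)⁻¹ • (π₀.smulRight p - π₁.smulRight p' + (π₀.smulRight p + π₁.smulRight p')) =
        π₀.smulRight p := by
      have h'' : π₀.smulRight p - π₁.smulRight p' + (π₀.smulRight p + π₁.smulRight p') =
          (2 : ℂ) • π₀.smulRight p := by
        rw [two_smul]; abel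
      rw [h'', smul_smul, inv_mul_cancel₀ two_ne_zero, one_smul]
    rwa [h'] at h
  exact UnitaryTwoOdd.eq_top_of_rankOne hbr hirr h00 he

end Module

end HodgeStructure

end Literature.AlgebraicGeometry.Motives

end
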